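import Mathlib
import Summits.Ventures.HodgeRepro2.T6N1Main
import Summits.Ventures.HodgeRepro2.T6NAut
import Summits.Ventures.HodgeRepro2.T6NAutToyN

/-!
# T6N1Obstruction — the four N1 displays are jointly refutable on every `NAut` carrier with a non-zero
pairing (README §10.5(ii)(a)/(d) for N1; owner t6-p1, gen 3; STATUS l. 11175 (2) / l. 11204)

NEGATIVE RESULT about the cell's own M2 carrier, proved in kernel. The M2 composition carrier `NAut F P`
(T6NAut) carries the field `data_surj`: EVERY quadruple of Schwartz data is realised by an ADMISSIBLE
choice. Together with the interface's projection formula `z_proj` (`∫_S f^* u = ∫_B z ∪ u` with a RATIONAL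
Gysin class `z` and a rational-valued `∫_B`) this is incompatible with the N1 identification
`I_{τ₁}(c) = ± c_K ⟨F_A(c), F_B(c)⟩` (`T6N1Main.I_eq`, a consequence of the four N1 displays):
* `nAut_displays_false_of_I_ne_zero`: a carrier whose period is non-zero at EVERY admissible choice cannot
  satisfy the displays — at the zero Schwartz data the pairing is `0`, so `I_eq` forces the period to vanish.
  Instance: the lead's non-degenerate toy `NAutToyN.toy` (`I_ne_zero` at every choice): `toy_displays_false`.
* `nAut_displays_false_of_exists_pairing_ne_zero`: for ANY period datum `P` (any family of shadows, even
  `c`-dependent) and ANY carrier `M` whose N3 datum has ONE quadruple with non-zero pairing, the displays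
  are jointly false. The period `I_{τ₁}(c) = ∫_S f^*(e_0 ∧ e_1 ∧ e_2 ∧ e_3)` lies, by `z_proj` applied to the
  rational monomial basis, in the COUNTABLE set `Λ(E)` of ℚ-linear combinations of the coordinates of
  `E = e_0 ∧ e_1 ∧ e_2 ∧ e_3` (`intS_pull_eq_sum`; `E` is independent of `c`), while `data_surj` realises
  the scalings `(t • φ_a, φ_b, φ_c, φ_d)` for every `t : ℂ` and `I_eq` then puts `± c_K · t · v` in `Λ(E)`
  for every `t` — `ℂ` would be countable (`not_countable_complex`).
READING (the bus line l. 11204): `data_surj` is the mis-modelling — the print's identification holds for the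
NORMALISED Schwartz data of (q2) / B7(b), not for their ℂ-scalings; the composition consumes `data_surj` only
through `exists_choice_of_pairing_ne_zero`, so the field can be weakened to what is consumed. Nothing here
touches the displays themselves (T6N1Hyp, faithful to the print; jointly satisfiable on the degenerate
T6N1Toy). No `sorry`; standard axioms.
§8(d): uses an L-value-free non-vanishing device: NO.
-/

namespace Summit.Ventures.HodgeRepro2.T6.N1Obstruction

open scoped InnerProductSpace

variable {K : Type} [Field K] [NumberField K]

/-! ## 1. The pointwise obstruction: a non-zero period at a choice with zero pairing -/

/-- Under the four displays, a choice with non-zero period and zero pairing is impossible (`I_eq`). -/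
theorem false_of_I_ne_zero_of_pairing_eq_zero {F : FaceSetting K} {P : NDatum F} {LG : Type}
    [NormedAddCommGroup LG] [InnerProductSpace ℂ LG] {FA FB : P.Choice → LG}
    (d : N1Datum F P LG FA FB) (hH : Hyp.Voisin2002_7_3_2 d) (hL : Hyp.Voisin2002_Lemma5_4_petersson d)
    (hA : Hyp.Liu2021_Prop4_13_vertexLiftA d) (hB : Hyp.Liu2021_Prop4_13_vertexLiftB d)
    {c : P.Choice} (hc : P.AdmChoice c) (hI : P.I P.τ₁ c ≠ 0) (hp : d.pairing c = 0) : False := by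
  rcases N1Main.I_eq d hH hL hA hB c hc with h | h
  · exact hI (by rw [h, hp, mul_zero])
  · exact hI (by rw [h, hp, mul_zero, neg_zero])

/-- A carrier `M : NAut F P` whose period is non-zero at EVERY admissible choice cannot satisfy the four N1
displays: `data_surj` realises the zero Schwartz data by an admissible choice, where the pairing is `0`. -/
theorem nAut_displays_false_of_I_ne_zero {F : FaceSetting K} {P : NDatum F} (M : NAut F P)
    (hI : ∀ c, P.AdmChoice c → P.I P.τ₁ c ≠ 0)
    (hH : Hyp.Voisin2002_7_3_2 M.d1) (hL : Hyp.Voisin2002_Lemma5_4_petersson M.d1)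
    (hA : Hyp.Liu2021_Prop4_13_vertexLiftA M.d1) (hB : Hyp.Liu2021_Prop4_13_vertexLiftB M.d1) : False := by
  obtain ⟨c, hc, hdata⟩ := M.data_surj 0 0 0 0
  refine false_of_I_ne_zero_of_pairing_eq_zero M.d1 hH hL hA hB hc (hI c hc) ?_
  simp [N1Datum.pairing, hdata]

/-- INSTANCE (STATUS l. 11175 (2)): on the lead's non-degenerate toy carrier `NAutToyN.toy` (period
non-zero at every choice, `NAutToyN.I_ne_zero`) the four N1 displays are jointly FALSE — for its N1 datum
`toyN1N`, and (by `nAut_displays_false_of_I_ne_zero`) for every other N1 datum wired into an `NAut` over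
`toyNDatumN`. -/
theorem toy_displays_false (F : FaceSetting K) {σ : K →+* ℂ} {w : KC K} (hw : w ∈ eigenLineK K σ)
    (hw0 : w ≠ 0) :
    ¬ (Hyp.Voisin2002_7_3_2 (NAutToyN.toyN1N F hw hw0) ∧
        Hyp.Voisin2002_Lemma5_4_petersson (NAutToyN.toyN1N F hw hw0) ∧
        Hyp.Liu2021_Prop4_13_vertexLiftA (NAutToyN.toyN1N F hw hw0) ∧
        Hyp.Liu2021_Prop4_13_vertexLiftB (NAutToyN.toyN1N F hw hw0)) :=
  fun ⟨hH, hL, hA, hB⟩ =>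
    nAut_displays_false_of_I_ne_zero (NAutToyN.toy F hw hw0) (fun c _ => NAutToyN.I_ne_zero F hw hw0 c)
      hH hL hA hB

/-! ## 2. The structural obstruction: the period lies in a countable set, the pairing does not -/

/-- THE RATIONALITY OF THE PERIOD: for every transfer shadow `D` (any `HS`, `f^*`, `∫_S`, `z`) and every
`E ∈ H^*(B, ℂ)`, `∫_S f^* E` is a ℚ-linear combination `∑_t E_t q_t` of the coordinates `E_t` of `E` in the
complex monomial basis `ToyN.bC K` (the base change of the rational monomial basis), with
`q_t = ∫_B z ∪ e_t ∈ ℚ` — by the projection formula `z_proj` on the rational monomial basis. -/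
theorem intS_pull_eq_sum {F : FaceSetting K} (D : TransferShadow F) (E : HBC K) :
    ∃ q : Finset (Fin (Module.finrank ℚ (H1 K))) → ℚ,
      D.intS (D.pull E) = ∑ t, (ToyN.bC K).ExteriorAlgebra.repr E t * (q t : ℂ) := by
  classical
  refine ⟨fun t => D.intB (D.z * (Toy.b1 K).ExteriorAlgebra t), ?_⟩
  have hE : E = ∑ t, (ToyN.bC K).ExteriorAlgebra.repr E t • extC K ((Toy.b1 K).ExteriorAlgebra t) := by
    conv_lhs => rw [← (ToyN.bC K).ExteriorAlgebra.sum_repr E]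
    refine Finset.sum_congr rfl fun t _ => ?_
    rw [ToyN.extC_basis]
  conv_lhs => rw [hE]
  rw [map_sum, map_sum]
  refine Finset.sum_congr rfl fun t _ => ?_
  rw [map_smul, map_smul, smul_eq_mul, ← D.z_proj]

/-- THE STRUCTURAL OBSTRUCTION: for ANY period datum `P` and ANY carrier `M : NAut F P` whose N3 datum has
one quadruple of Schwartz data with non-zero pairing, the four N1 displays on `M.d1` are jointly false:
`data_surj` realises every scaling `(t • φ_a, φ_b, φ_c, φ_d)` by an admissible choice, `I_eq` identifies the
period there with `± c_K · t · ⟨F_B, F_A⟩`, and the period lies in the countable set `Λ(E)` — so `ℂ` would be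
countable. -/
theorem nAut_displays_false_of_exists_pairing_ne_zero {F : FaceSetting K} {P : NDatum F} (M : NAut F P)
    (hv : ∃ (φa : M.d3.A.Sa) (φb : M.d3.A.Sb) (φc : M.d3.B.Sa) (φd : M.d3.B.Sb),
      ⟪M.d3.B.F φc φd, M.d3.A.F φa φb⟫_ℂ ≠ 0)
    (hH : Hyp.Voisin2002_7_3_2 M.d1) (hL : Hyp.Voisin2002_Lemma5_4_petersson M.d1)
    (hA : Hyp.Liu2021_Prop4_13_vertexLiftA M.d1) (hB : Hyp.Liu2021_Prop4_13_vertexLiftB M.d1) : False := by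
  classical
  obtain ⟨φa, φb, φc, φd, hv⟩ := hv
  set E : HBC K := ExteriorAlgebra.ι ℂ (P.e P.τ₁ 0) * ExteriorAlgebra.ι ℂ (P.e P.τ₁ 1) *
    ExteriorAlgebra.ι ℂ (P.e P.τ₁ 2) * ExteriorAlgebra.ι ℂ (P.e P.τ₁ 3) with hEdef
  set v : ℂ := ⟪M.d3.B.F φc φd, M.d3.A.F φa φb⟫_ℂ with hvdef
  have hcK : (M.d1.cK : ℂ) ≠ 0 := by exact_mod_cast M.d1.cK_pos.ne'
  -- `Λ(E)`: the ℚ-linear combinations of the coordinates of `E`; a countable subset of `ℂ`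
  set Λ : Set ℂ := Set.range fun q : Finset (Fin (Module.finrank ℚ (H1 K))) → ℚ =>
    ∑ t, (ToyN.bC K).ExteriorAlgebra.repr E t * (q t : ℂ) with hΛdef
  have hΛ : Λ.Countable := Set.countable_range _
  set S : Set ℂ := Λ ∪ (fun x : ℂ => -x) '' Λ with hSdef
  have hS : S.Countable := hΛ.union (hΛ.image _)
  -- every scaling of the pairing, times `± c_K`, is a period, hence lies in `Λ(E)`
  have key : ∀ t : ℂ, (M.d1.cK : ℂ) * (t * v) ∈ S := by
    intro t
    obtain ⟨c, hc, hdata⟩ := M.data_surj (t • φa) φb φc φd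
    have hpair : M.d1.pairing c = t * v := by
      simp [N1Datum.pairing, hdata, hvdef]
    have hI : P.I P.τ₁ c ∈ Λ := by
      obtain ⟨q, hq⟩ := intS_pull_eq_sum (P.shadow c) E
      exact ⟨q, hq.symm⟩
    rcases N1Main.I_eq M.d1 hH hL hA hB c hc with h | h
    · exact Or.inl (by rw [← hpair, ← h]; exact hI)
    · exact Or.inr ⟨P.I P.τ₁ c, hI, by rw [h, hpair]; exact neg_neg _⟩
  have hinj : Function.Injective fun t : ℂ => (M.d1.cK : ℂ) * (t * v) := by
    intro a b h
    have h' : ((M.d1.cK : ℂ) * v) * a = ((M.d1.cK : ℂ) * v) * b := by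
      simp only at h
      linear_combination h
    exact mul_left_cancel₀ (mul_ne_zero hcK hv) h'
  apply not_countable_complex
  refine (hS.preimage hinj).mono ?_
  intro t _
  exact key t

end Summit.Ventures.HodgeRepro2.T6.N1Obstruction
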